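import Mathlib
import HarnessLib
import Summits.Ventures.LatticeQCDFlow.Scoring.IMHAcceptanceRecord
import Summits.Ventures.LatticeQCDFlow.Scoring.IMHAcceptanceRecordEnvelope
import Summits.Ventures.LatticeQCDFlow.Scoring.DoeblinAutocorrelation
import Summits.Ventures.LatticeQCDFlow.Exactness.ApproxTrivializingSampler

/-!
# The acceptance record of the exact flow-MCMC chain, III: what the accepted rows sample

HONEST FRAMING: exact (Metropolis-corrected) sampling algorithms for lattice gauge theory;
figures of merit are autocorrelation/cost numbers at stated couplings and volumes; no
continuum-physics claim.

Venture `LatticeQCDFlow` (cell pub-lqcd), topic `Scoring`; flow / samplers seat (GEN-38).  NEW WORK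
of the cell, not a published result; nothing is cited as a fact (printed counterparts NAMED ONLY:
Douc–Robert 2011, Lemma 1 — the accepted states of a Metropolis–Hastings chain have stationary
law `∝ p · π`, `p` the local acceptance probability, importance weight `1/p`; Liu 1996;
Bhatia–Davis 2000).  Pure measure theory over `Scoring/IMHAcceptanceRecord.lean` (the record
kernel `imhRecord`, `π̂ = imhRecord q w ∘ₘ π`, THE RECORD LAW `integral_acceptFlag_mul`),
`Scoring/IMHAcceptanceRecordEnvelope.lean` (Bhatia–Davis, the floor `1/M`), row 8's `autocov_zero`
and `sq_integral_mul_le`, and `Exactness.flowSampler_exact_doeblin` — the general-state-space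
counterpart, for the flow sampler's record, of row 13's finite ENTRY-STATE TILT
(`Exactness/EntryStateTilt.lean`).  No number from any run enters; nothing here ranks samplers.
Setting (as in I, II): MODEL `q`, TARGET `π` invariant for `K = indepMH q w`, `w > 0` measurable,
`α(x) = (imhAcceptMass q w x).toReal` the LOCAL ACCEPTANCE RATE, `ā = ∫ α dπ`, `A = acceptFlag`,
`E_acc H = (∫ A · (H ∘ fst) dπ̂) / (∫ A dπ̂)` the stationary mean of a bounded observable `H` over
the ACCEPTED rows (what is estimated when only accepted configurations are stored), `H̄ = ∫ H dπ`,
`V_H = ∫ (H − H̄)² dπ`, `V_α = ∫ (α − ā)² dπ`, `C_A(1)` the lag-one autocovariance of the flags.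
* LAW OF THE ACCEPTED ROWS `real_comp_imhRecord_prod_true`: `π̂(S × {accept}) = ∫_S α dπ` — the
  accepted rows sample the `α`-TILT `α π / ā`, not `π` (`α > 0`, `ā > 0`).
* TILT IDENTITY `acceptedMean_sub_mean_eq`: `E_acc H − H̄ = Cov_π(α, H) / ā`; hence
  `|E_acc H − H̄| ≤ √(V_α V_H) / ā`, and since `V_α = C_A(1)` (THE RECORD LAW at lag one) the bias
  is READ OFF THE RECORD: `|E_acc H − H̄| ≤ √(C_A(1) · V_H) / E_π̂ A` (`…_le_record`).
* SIGN `acceptedMean_le_mean_of_monotone`: `α` is antitone in the weight, so (Chebyshev's order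
  inequality) EVERY observable monotone in the weight is biased DOWN on the accepted rows.
* SOJOURN COMPENSATION `integral_acceptFlag_mul_div_acceptRate`: under a floor `α ≥ m > 0` (`1/M`
  under `0 < w ≤ M`), weighting each accepted row by `1/α(state)`, its mean sojourn, restores `π`
  EXACTLY; CEILING `abs_acceptedMean_sub_mean_le_of_floor`: `|E_acc H − H̄| ≤ (1 − m)/(2√m) · √V_H`.
* Lattice instance `flowSampler_acceptedRows_bias_le` (Lüscher defect `≤ δ`, every volume): the
  `1/α`-weighted accepted configurations are exactly Boltzmann, and the plain accepted-rows mean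
  of every bounded observable is within `sinh δ · √V_H` of its Boltzmann mean.
NOT CLAIMED: any number of ours; the path-level geometric law of the sojourns (only its one-row
stationary form enters, through `integral_acceptFlag_mul`); finite-stream estimators or a CLT;
sharpness of `(1 − m)/(2√m)`; cost; anything deciding between samplers.
-/

noncomputable section
namespace Summit.Ventures.LatticeQCDFlow.Scoring
open MeasureTheory ProbabilityTheory Filter Finset Summit.Ventures.LatticeQCDFlow.Exactness
open scoped ENNReal

variable {Ω : Type*} [MeasurableSpace Ω]

/-! ### Lemmas on bounded observables of a probability law (file-local namespace) -/

namespace IMHAcceptanceRecordTilt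

/-- `∫ (f − a)(g − b) dμ = ∫ f g dμ − a ∫ g dμ − b ∫ f dμ + a b` for bounded measurable `f, g`
and a probability law `μ`. -/
theorem integral_sub_const_mul_sub_const (μ : Measure Ω) [IsProbabilityMeasure μ] {f g : Ω → ℝ}
    (hf : Measurable f) (hg : Measurable g) {Cf Cg : ℝ} (hCf : ∀ x, |f x| ≤ Cf)
    (hCg : ∀ x, |g x| ≤ Cg) (a b : ℝ) :
    ∫ x, (f x - a) * (g x - b) ∂μ
      = ∫ x, f x * g x ∂μ - a * ∫ x, g x ∂μ - b * ∫ x, f x ∂μ + a * b := by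
  have hIf : Integrable f μ := integrable_of_bounded μ hf hCf
  have hIg : Integrable g μ := integrable_of_bounded μ hg hCg
  have hIfg : Integrable (fun x => f x * g x) μ :=
    integrable_of_bounded μ (hf.mul hg) (C := Cf * Cg) fun x => by
      rw [abs_mul]
      exact mul_le_mul (hCf x) (hCg x) (abs_nonneg _) ((abs_nonneg _).trans (hCf x))
  have hI1 : Integrable (fun x => a * g x) μ := hIg.const_mul _
  have hI2 : Integrable (fun x => b * f x) μ := hIf.const_mul _
  have hI3 : Integrable (fun x => f x * g x - a * g x) μ := hIfg.sub hI1
  have hI4 : Integrable (fun x => f x * g x - a * g x - b * f x) μ := hI3.sub hI2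
  have hexp : ∀ x, (f x - a) * (g x - b) = f x * g x - a * g x - b * f x + a * b := fun x => by
    ring
  simp_rw [hexp]
  rw [integral_add hI4 (integrable_const _), integral_sub hI3 hI2, integral_sub hIfg hI1,
    integral_const_mul, integral_const_mul, integral_const, probReal_univ, one_smul]

/-- Centred second moments: `∫ (f − f̄)(g − ḡ) dμ = ∫ f g dμ − f̄ ḡ`. -/
theorem integral_centred_mul (μ : Measure Ω) [IsProbabilityMeasure μ] {f g : Ω → ℝ}
    (hf : Measurable f) (hg : Measurable g) {Cf Cg : ℝ} (hCf : ∀ x, |f x| ≤ Cf)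
    (hCg : ∀ x, |g x| ≤ Cg) :
    ∫ x, (f x - ∫ y, f y ∂μ) * (g x - ∫ y, g y ∂μ) ∂μ
      = ∫ x, f x * g x ∂μ - (∫ y, f y ∂μ) * ∫ y, g y ∂μ := by
  rw [integral_sub_const_mul_sub_const μ hf hg hCf hCg]
  ring

/-- **Chebyshev's order inequality**: `(f x − f y)(g x − g y) ≤ 0` for all `x, y` gives
`∫ f g dμ ≤ (∫ f dμ)(∫ g dμ)` for a probability law `μ` (integrate in `y`, then in `x`). -/
theorem integral_mul_le_of_antivary (μ : Measure Ω) [IsProbabilityMeasure μ] {f g : Ω → ℝ}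
    (hf : Measurable f) (hg : Measurable g) {Cf Cg : ℝ} (hCf : ∀ x, |f x| ≤ Cf)
    (hCg : ∀ x, |g x| ≤ Cg) (hanti : ∀ x y, (f x - f y) * (g x - g y) ≤ 0) :
    ∫ x, f x * g x ∂μ ≤ (∫ x, f x ∂μ) * ∫ x, g x ∂μ := by
  have hbf : ∀ x, |f x - ∫ y, f y ∂μ| ≤ Cf + |∫ y, f y ∂μ| := fun x =>
    (abs_sub _ _).trans (add_le_add (hCf x) le_rfl)
  have hI : Integrable (fun x => (f x - ∫ y, f y ∂μ) * (g x - ∫ y, g y ∂μ)) μ :=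
    integrable_of_bounded μ ((hf.sub measurable_const).mul (hg.sub measurable_const))
      (C := (Cf + |∫ y, f y ∂μ|) * (Cg + |∫ y, g y ∂μ|)) fun x => by
        rw [abs_mul]
        exact mul_le_mul (hbf x) ((abs_sub _ _).trans (add_le_add (hCg x) le_rfl))
          (abs_nonneg _) ((abs_nonneg _).trans (hbf x))
  have hpt : ∀ x, (f x - ∫ y, f y ∂μ) * (g x - ∫ y, g y ∂μ)
      ≤ (∫ y, f y ∂μ) * (∫ y, g y ∂μ) - ∫ y, f y * g y ∂μ := fun x => by
    have h0 : ∫ y, (f y - f x) * (g y - g x) ∂μ ≤ 0 :=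
      integral_nonpos fun y => show (f y - f x) * (g y - g x) ≤ 0 by nlinarith [hanti x y]
    rw [integral_sub_const_mul_sub_const μ hf hg hCf hCg] at h0
    linarith
  have h1 := integral_mono hI (integrable_const _) hpt
  rw [integral_const, probReal_univ, one_smul, integral_sub_const_mul_sub_const μ hf hg hCf hCg]
    at h1
  linarith

/-- The constant of §3 at the floor `m = e^{−2δ}` is `sinh δ`. -/
theorem tiltConst_exp_eq_sinh (δ : ℝ) :
    (1 - Real.exp (-(2 * δ))) / (2 * Real.sqrt (Real.exp (-(2 * δ)))) = Real.sinh δ := by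
  have h2 : Real.exp (-(2 * δ)) = Real.exp (-δ) * Real.exp (-δ) := by
    rw [← Real.exp_add]; congr 1; ring
  have h1 : Real.sqrt (Real.exp (-(2 * δ))) = Real.exp (-δ) := by
    rw [h2, Real.sqrt_mul_self (Real.exp_pos _).le]
  have h3 : Real.exp δ * Real.exp (-δ) = 1 := by
    rw [← Real.exp_add, add_neg_cancel, Real.exp_zero]
  rw [h1, h2, Real.sinh_eq, div_eq_div_iff (by positivity) two_ne_zero]
  linear_combination (-2 : ℝ) * h3

end IMHAcceptanceRecordTilt

open IMHAcceptanceRecordTilt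

variable {q : Measure Ω} [IsProbabilityMeasure q] {w : Ω → ℝ} {π : Measure Ω}

/-! ### §1 The accepted rows sample the `α`-tilt of `π` -/

omit [MeasurableSpace Ω] in
/-- `A(z) · 1_S(z.1) = 1_{S × {accept}}(z)`. -/
theorem acceptFlag_mul_indicator (S : Set Ω) (z : Ω × Bool) :
    acceptFlag z * S.indicator 1 z.1 = (S ×ˢ ({true} : Set Bool)).indicator 1 z := by
  obtain ⟨x, b⟩ := z
  cases b <;> by_cases hx : x ∈ S <;> simp [acceptFlag, hx, Set.mem_prod]

/-- **LAW OF THE ACCEPTED ROWS**: `π̂(S × {accept}) = ∫_S α dπ` — in the stationary record the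
accepted rows sample the `α`-tilt of `π` (total mass `ā`), not `π`. -/
theorem real_comp_imhRecord_prod_true (hw : Measurable w) (hw0 : ∀ x, 0 < w x)
    [IsProbabilityMeasure π] (hinv : Kernel.Invariant (indepMH q w) π) {S : Set Ω}
    (hS : MeasurableSet S) :
    (imhRecord q w ∘ₘ π).real (S ×ˢ ({true} : Set Bool))
      = ∫ x in S, (imhAcceptMass q w x).toReal ∂π := by
  have h := integral_acceptFlag_mul hw hw0 hinv (H := S.indicator 1) (measurable_one.indicator hS)
    (C := 1) (fun x => by by_cases hx : x ∈ S <;> simp [hx])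
  have h2 : ∀ x, (imhAcceptMass q w x).toReal * S.indicator 1 x
      = S.indicator (fun x => (imhAcceptMass q w x).toReal) x := fun x => by
    by_cases hx : x ∈ S <;> simp [hx]
  simp_rw [acceptFlag_mul_indicator, h2,
    integral_indicator_one (hS.prod (measurableSet_singleton true)), integral_indicator hS] at h
  exact h

/-- The local acceptance rate is positive at every state … -/
theorem toReal_imhAcceptMass_pos (hw : Measurable w) (hw0 : ∀ x, 0 < w x) (x : Ω) :
    0 < (imhAcceptMass q w x).toReal := by
  have hpos : ∀ y, 0 < imhAccept w x y := fun y => by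
    unfold imhAccept; exact lt_min one_pos (div_pos (hw0 y) (hw0 x))
  rw [toReal_imhAcceptMass hw hw0,
    integral_pos_iff_support_of_nonneg (fun y => (hpos y).le)
      (integrable_of_bounded q (measurable_imhAccept_right hw x) (C := 1) fun y => by
        rw [abs_of_pos (hpos y)]; exact imhAccept_le_one w x y),
    Set.eq_univ_of_forall fun y => Function.mem_support.2 (hpos y).ne', measure_univ]
  exact one_pos

/-- … hence so is the mean acceptance `ā = ∫ α dπ` of every probability law `π`. -/
theorem integral_toReal_imhAcceptMass_pos (hw : Measurable w) (hw0 : ∀ x, 0 < w x)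
    [IsProbabilityMeasure π] : 0 < ∫ x, (imhAcceptMass q w x).toReal ∂π := by
  rw [integral_pos_iff_support_of_nonneg (fun x => ENNReal.toReal_nonneg)
      (integrable_of_bounded π (measurable_toReal_imhAcceptMass (q := q) hw)
        abs_toReal_imhAcceptMass_le),
    Set.eq_univ_of_forall fun x =>
      Function.mem_support.2 (toReal_imhAcceptMass_pos (q := q) hw hw0 x).ne', measure_univ]
  exact one_pos

/-- **THE TILT IDENTITY**: `E_acc H − H̄ = Cov_π(α, H) / ā` — the stationary mean of a bounded
observable over the ACCEPTED rows is off target by its covariance with the acceptance rate. -/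
theorem acceptedMean_sub_mean_eq (hw : Measurable w) (hw0 : ∀ x, 0 < w x)
    [IsProbabilityMeasure π] (hinv : Kernel.Invariant (indepMH q w) π) {H : Ω → ℝ}
    (hH : Measurable H) {C : ℝ} (hC : ∀ x, |H x| ≤ C) :
    (∫ z, acceptFlag z * H z.1 ∂(imhRecord q w ∘ₘ π)) / (∫ z, acceptFlag z ∂(imhRecord q w ∘ₘ π))
        - ∫ x, H x ∂π
      = (∫ x, ((imhAcceptMass q w x).toReal - ∫ y, (imhAcceptMass q w y).toReal ∂π)
            * (H x - ∫ y, H y ∂π) ∂π) / ∫ x, (imhAcceptMass q w x).toReal ∂π := by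
  have hā := integral_toReal_imhAcceptMass_pos (q := q) (π := π) hw hw0
  rw [integral_acceptFlag_mul hw hw0 hinv hH hC, integral_acceptFlag hw hw0 hinv,
    integral_centred_mul π (measurable_toReal_imhAcceptMass (q := q) hw) hH
      abs_toReal_imhAcceptMass_le hC, eq_div_iff hā.ne', sub_mul, div_mul_cancel₀ _ hā.ne']
  ring

/-- **THE TILT BIAS BOUND**: `|E_acc H − H̄| ≤ √(V_α · V_H) / ā` (Cauchy–Schwarz). -/
theorem abs_acceptedMean_sub_mean_le (hw : Measurable w) (hw0 : ∀ x, 0 < w x)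
    [IsProbabilityMeasure π] (hinv : Kernel.Invariant (indepMH q w) π) {H : Ω → ℝ}
    (hH : Measurable H) {C : ℝ} (hC : ∀ x, |H x| ≤ C) :
    |(∫ z, acceptFlag z * H z.1 ∂(imhRecord q w ∘ₘ π)) / (∫ z, acceptFlag z ∂(imhRecord q w ∘ₘ π))
        - ∫ x, H x ∂π|
      ≤ Real.sqrt ((∫ x, ((imhAcceptMass q w x).toReal
              - ∫ y, (imhAcceptMass q w y).toReal ∂π) ^ 2 ∂π)
            * ∫ x, (H x - ∫ y, H y ∂π) ^ 2 ∂π)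
          / ∫ x, (imhAcceptMass q w x).toReal ∂π := by
  have hā := integral_toReal_imhAcceptMass_pos (q := q) (π := π) hw hw0
  rw [acceptedMean_sub_mean_eq hw hw0 hinv hH hC, abs_div, abs_of_pos hā]
  refine div_le_div_of_nonneg_right (Real.abs_le_sqrt ?_) hā.le
  exact sq_integral_mul_le π ((measurable_toReal_imhAcceptMass (q := q) hw).sub measurable_const)
    (hH.sub measurable_const) (Cf := 1 + |∫ y, (imhAcceptMass q w y).toReal ∂π|)
    (Cu := C + |∫ y, H y ∂π|)
    (fun x => (abs_sub _ _).trans (add_le_add (abs_toReal_imhAcceptMass_le x) le_rfl))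
    (fun x => (abs_sub _ _).trans (add_le_add (hC x) le_rfl))

/-- **THE TILT BIAS, READ OFF THE RECORD**: `V_α = C_A(1)` (THE RECORD LAW of I at lag one,
`autocov_centred_acceptFlag_succ`), so `|E_acc H − H̄| ≤ √(C_A(1) · V_H) / E_π̂ A` — the lag-one
autocovariance of the accept flags controls the bias of the accepted-rows mean of EVERY bounded
observable, in units of its standard deviation. -/
theorem abs_acceptedMean_sub_mean_le_record (hw : Measurable w) (hw0 : ∀ x, 0 < w x)
    [IsProbabilityMeasure π] (hinv : Kernel.Invariant (indepMH q w) π) {H : Ω → ℝ}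
    (hH : Measurable H) {C : ℝ} (hC : ∀ x, |H x| ≤ C) :
    |(∫ z, acceptFlag z * H z.1 ∂(imhRecord q w ∘ₘ π)) / (∫ z, acceptFlag z ∂(imhRecord q w ∘ₘ π))
        - ∫ x, H x ∂π|
      ≤ Real.sqrt (autocov (Kernel.prodMkRight Bool (imhRecord q w)) (imhRecord q w ∘ₘ π)
              (fun z => acceptFlag z - ∫ z', acceptFlag z' ∂(imhRecord q w ∘ₘ π)) 1
            * ∫ x, (H x - ∫ y, H y ∂π) ^ 2 ∂π)
          / ∫ z, acceptFlag z ∂(imhRecord q w ∘ₘ π) := by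
  have h := abs_acceptedMean_sub_mean_le hw hw0 hinv hH hC
  rw [← autocov_zero (indepMH q w) π, ← autocov_centred_acceptFlag_succ hw hw0 hinv 0,
    ← integral_acceptFlag hw hw0 hinv] at h
  exact h

/-! ### §2 The sign of the tilt: high weight is under-represented among the accepted rows -/

/-- **`α` is antitone in the weight**: `w x ≤ w x' → α(x') ≤ α(x)`. -/
theorem toReal_imhAcceptMass_anti (hw : Measurable w) (hw0 : ∀ x, 0 < w x) {x x' : Ω}
    (h : w x ≤ w x') : (imhAcceptMass q w x').toReal ≤ (imhAcceptMass q w x).toReal := by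
  have hb : ∀ x y, |imhAccept w x y| ≤ 1 := fun x y => by
    rw [abs_of_nonneg (imhAccept_nonneg hw0 x y)]; exact imhAccept_le_one w x y
  rw [toReal_imhAcceptMass hw hw0, toReal_imhAcceptMass hw hw0]
  refine integral_mono (integrable_of_bounded q (measurable_imhAccept_right hw x') (hb x'))
    (integrable_of_bounded q (measurable_imhAccept_right hw x) (hb x)) fun y => ?_
  show min 1 (w y / w x') ≤ min 1 (w y / w x)
  exact min_le_min_left 1 (div_le_div_of_nonneg_left (hw0 y).le (hw0 x) h)

/-- **Every observable monotone in the weight is biased DOWN on the accepted rows**: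
`(w x ≤ w y → H x ≤ H y) ⇒ E_acc H ≤ ∫ H dπ` (Chebyshev's order inequality). -/
theorem acceptedMean_le_mean_of_monotone (hw : Measurable w) (hw0 : ∀ x, 0 < w x)
    [IsProbabilityMeasure π] (hinv : Kernel.Invariant (indepMH q w) π) {H : Ω → ℝ}
    (hH : Measurable H) {C : ℝ} (hC : ∀ x, |H x| ≤ C)
    (hmono : ∀ x y, w x ≤ w y → H x ≤ H y) :
    (∫ z, acceptFlag z * H z.1 ∂(imhRecord q w ∘ₘ π)) / (∫ z, acceptFlag z ∂(imhRecord q w ∘ₘ π))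
      ≤ ∫ x, H x ∂π := by
  have hā := integral_toReal_imhAcceptMass_pos (q := q) (π := π) hw hw0
  have hanti : ∀ x y, ((imhAcceptMass q w x).toReal - (imhAcceptMass q w y).toReal)
      * (H x - H y) ≤ 0 := fun x y => by
    rcases le_total (w x) (w y) with hxy | hyx
    · exact mul_nonpos_iff.2 (Or.inl ⟨sub_nonneg.2 (toReal_imhAcceptMass_anti hw hw0 hxy),
        sub_nonpos.2 (hmono x y hxy)⟩)
    · exact mul_nonpos_iff.2 (Or.inr ⟨sub_nonpos.2 (toReal_imhAcceptMass_anti hw hw0 hyx),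
        sub_nonneg.2 (hmono y x hyx)⟩)
  rw [integral_acceptFlag_mul hw hw0 hinv hH hC, integral_acceptFlag hw hw0 hinv, div_le_iff₀ hā]
  calc ∫ x, (imhAcceptMass q w x).toReal * H x ∂π
      ≤ (∫ x, (imhAcceptMass q w x).toReal ∂π) * ∫ x, H x ∂π :=
        integral_mul_le_of_antivary π (measurable_toReal_imhAcceptMass (q := q) hw) hH
          abs_toReal_imhAcceptMass_le hC hanti
    _ = (∫ x, H x ∂π) * ∫ x, (imhAcceptMass q w x).toReal ∂π := mul_comm _ _

/-! ### §3 Sojourn compensation, and the ceiling on the tilt bias under an acceptance floor -/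

/-- **SOJOURN COMPENSATION**: under an acceptance floor `α ≥ m > 0`, weighting every accepted
row by `1/α(state)` (its mean sojourn) restores the target exactly:
`∫ A · ((H/α) ∘ fst) dπ̂ = ∫ H dπ` for bounded measurable `H`. -/
theorem integral_acceptFlag_mul_div_acceptRate (hw : Measurable w) (hw0 : ∀ x, 0 < w x)
    [IsProbabilityMeasure π] (hinv : Kernel.Invariant (indepMH q w) π) {H : Ω → ℝ}
    (hH : Measurable H) {C : ℝ} (hC : ∀ x, |H x| ≤ C) {m : ℝ} (hm : 0 < m)
    (hfl : ∀ x, m ≤ (imhAcceptMass q w x).toReal) :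
    ∫ z, acceptFlag z * (H z.1 / (imhAcceptMass q w z.1).toReal) ∂(imhRecord q w ∘ₘ π)
      = ∫ x, H x ∂π := by
  have hαm := measurable_toReal_imhAcceptMass (q := q) hw
  have hαpos : ∀ x, 0 < (imhAcceptMass q w x).toReal := fun x => hm.trans_le (hfl x)
  have h := integral_acceptFlag_mul hw hw0 hinv
    (H := fun x => H x / (imhAcceptMass q w x).toReal) (hH.div hαm) (C := C / m) fun x => by
      rw [abs_div, abs_of_pos (hαpos x)]
      exact div_le_div₀ ((abs_nonneg _).trans (hC x)) (hC x) hm (hfl x)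
  refine h.trans (integral_congr_ae (ae_of_all _ fun x => ?_))
  show (imhAcceptMass q w x).toReal * (H x / (imhAcceptMass q w x).toReal) = H x
  rw [mul_div_assoc', mul_div_cancel_left₀ _ (hαpos x).ne']

/-- The floor of II in real form: `0 < w ≤ M`, `π = w · q` a probability law ⇒ `1/M ≤ α(x)`. -/
theorem one_div_le_toReal_imhAcceptMass_of_le (hw : Measurable w) (hw0 : ∀ x, 0 < w x) {M : ℝ}
    (hM : ∀ x, w x ≤ M) [IsProbabilityMeasure π]
    (hπ : (q.withDensity fun x => ENNReal.ofReal (w x)) = π) (x : Ω) :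
    1 / M ≤ (imhAcceptMass q w x).toReal := by
  have hMpos : 0 < M := (hw0 x).trans_le (hM x)
  have h := ENNReal.toReal_mono
    (ne_top_of_le_ne_top ENNReal.one_ne_top (imhAcceptMass_le_one q w x))
    (inv_le_imhAcceptMass_of_le hw hw0 hM hπ x)
  rwa [ENNReal.toReal_inv, ENNReal.toReal_ofReal hMpos.le, ← one_div] at h

/-- **THE CEILING ON THE TILT BIAS** under an acceptance floor `α ≥ m > 0`: for EVERY bounded
measurable `H`, `|E_acc H − H̄| ≤ (1 − m)/(2√m) · √V_H`. -/
theorem abs_acceptedMean_sub_mean_le_of_floor (hw : Measurable w) (hw0 : ∀ x, 0 < w x)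
    [IsProbabilityMeasure π] (hinv : Kernel.Invariant (indepMH q w) π) {H : Ω → ℝ}
    (hH : Measurable H) {C : ℝ} (hC : ∀ x, |H x| ≤ C) {m : ℝ} (hm : 0 < m)
    (hfl : ∀ x, m ≤ (imhAcceptMass q w x).toReal) :
    |(∫ z, acceptFlag z * H z.1 ∂(imhRecord q w ∘ₘ π)) / (∫ z, acceptFlag z ∂(imhRecord q w ∘ₘ π))
        - ∫ x, H x ∂π|
      ≤ (1 - m) / (2 * Real.sqrt m) * Real.sqrt (∫ x, (H x - ∫ y, H y ∂π) ^ 2 ∂π) := by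
  obtain ⟨x0⟩ := nonempty_of_isProbabilityMeasure π
  have hā := integral_toReal_imhAcceptMass_pos (q := q) (π := π) hw hw0
  refine (abs_acceptedMean_sub_mean_le hw hw0 hinv hH hC).trans ?_
  set ā := ∫ x, (imhAcceptMass q w x).toReal ∂π
  have hα1 : ∀ x, (imhAcceptMass q w x).toReal ≤ 1 := fun x =>
    (le_abs_self _).trans (abs_toReal_imhAcceptMass_le x)
  have hm1 : m ≤ 1 := (hfl x0).trans (hα1 x0)
  have hVα0 : 0 ≤ ∫ x, ((imhAcceptMass q w x).toReal - ā) ^ 2 ∂π :=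
    integral_nonneg fun x => sq_nonneg _
  have hR0 : 0 ≤ (1 - m) / (2 * Real.sqrt m) * ā :=
    mul_nonneg (div_nonneg (sub_nonneg.2 hm1) (by positivity)) hā.le
  -- Bhatia–Davis on `[m, 1]`, then `4 m (ā − m)(1 − ā) ≤ (1 − m)² ā²`
  have hsα : Real.sqrt (∫ x, ((imhAcceptMass q w x).toReal - ā) ^ 2 ∂π)
      ≤ (1 - m) / (2 * Real.sqrt m) * ā := by
    refine (Real.sqrt_le_left hR0).2 ((IMHAcceptanceRecordEnvelope.integral_sq_sub_le_of_mem_Icc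
      π (measurable_toReal_imhAcceptMass (q := q) hw) hfl hα1).trans ?_)
    rw [mul_pow, div_pow, mul_pow, Real.sq_sqrt hm.le, div_mul_eq_mul_div,
      le_div_iff₀ (by positivity)]
    nlinarith [sq_nonneg ((1 + m) * ā - 2 * m)]
  rw [div_le_iff₀ hā, Real.sqrt_mul hVα0]
  calc _ ≤ (1 - m) / (2 * Real.sqrt m) * ā * Real.sqrt (∫ x, (H x - ∫ y, H y ∂π) ^ 2 ∂π) :=
        mul_le_mul_of_nonneg_right hsα (Real.sqrt_nonneg _)
    _ = _ := by ring

/-! ### §4 The lattice instance -/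

section Lattice

open Literature.MathematicalPhysics.QuantumFieldTheory
open Literature.MathematicalPhysics.QuantumFieldTheory.Luscher2010
open Summit.Ventures.LatticeQCDFlow.TrivializingMaps
open IMHAcceptanceRecordTilt
open scoped Matrix Matrix.Norms.Frobenius ContDiff

variable {d L n : ℕ} [NeZero L]

/-- **WHAT THE ACCEPTED CONFIGURATIONS OF AN EXACT FLOW SAMPLER SAMPLE.**  `SU(n)` on `(ℤ/L)^d`,
smooth action `S`, an approximately trivializing flow `Φ` (smooth generator `F`, Lüscher defect
`|L_t(F_t) − S − c t| ≤ δ` on `[0, 1]`), model `q = (Φ 1)_* D[V]`, target `π` = Boltzmann: for a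
measurable weight `w` with `w · q = π`, `π K = π`, acceptance `≥ e^{−2δ}` everywhere, and EVERY
bounded measurable `H`, at every volume: the `1/α`-weighted accepted configurations of the
stationary record are exactly `π`-distributed, and the plain accepted-rows mean of `H` is within
`sinh δ · √V_H` of `∫ H dπ`.  (Instance: `isProbabilityMeasure_boltzmannMeasure`.) -/
theorem flowSampler_acceptedRows_bias_le (B : SuBasis n)
    {S : AmbConfig d L n → ℝ} (hS : ContDiff ℝ ∞ S) {F : ℝ → AmbConfig d L n → ℝ}
    (hF : ContDiff ℝ ∞ fun p : ℝ × AmbConfig d L n => F p.1 p.2)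
    {Φ : ℝ → GaugeConfig d L (Matrix.specialUnitaryGroup (Fin n) ℂ) →
      GaugeConfig d L (Matrix.specialUnitaryGroup (Fin n) ℂ)}
    (hΦ : IsFlowMap (fun t W => -linkGrad B (F t) W) Φ) {c : ℝ → ℝ} {δ : ℝ}
    (hδ : ∀ t ∈ Set.Icc (0 : ℝ) 1, ∀ U : GaugeConfig d L (Matrix.specialUnitaryGroup (Fin n) ℂ),
      |luscherL B S t (F t) (WilsonFlow.coeConfig U) - S (WilsonFlow.coeConfig U) - c t| ≤ δ)
    (q : Measure (GaugeConfig d L (Matrix.specialUnitaryGroup (Fin n) ℂ))) [IsProbabilityMeasure q]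
    (hq : q = Measure.map (Φ 1) (trivialMeasure (Matrix.specialUnitaryGroup (Fin n) ℂ) d L))
    {π : Measure (GaugeConfig d L (Matrix.specialUnitaryGroup (Fin n) ℂ))}
    (hπB : π = boltzmannMeasure fun U : GaugeConfig d L (Matrix.specialUnitaryGroup (Fin n) ℂ) =>
      S (WilsonFlow.coeConfig U)) :
    ∃ w : GaugeConfig d L (Matrix.specialUnitaryGroup (Fin n) ℂ) → ℝ, Measurable w ∧
      (q.withDensity fun U => ENNReal.ofReal (w U)) = π ∧ Kernel.Invariant (indepMH q w) π ∧
      (∀ U, Real.exp (-(2 * δ)) ≤ (imhAcceptMass q w U).toReal) ∧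
      ∀ H : GaugeConfig d L (Matrix.specialUnitaryGroup (Fin n) ℂ) → ℝ, Measurable H →
        ∀ C : ℝ, (∀ U, |H U| ≤ C) →
        (∫ z, acceptFlag z * (H z.1 / (imhAcceptMass q w z.1).toReal) ∂(imhRecord q w ∘ₘ π)
            = ∫ U, H U ∂π) ∧
        |(∫ z, acceptFlag z * H z.1 ∂(imhRecord q w ∘ₘ π))
              / (∫ z, acceptFlag z ∂(imhRecord q w ∘ₘ π)) - ∫ U, H U ∂π|
          ≤ Real.sinh δ * Real.sqrt (∫ U, (H U - ∫ V, H V ∂π) ^ 2 ∂π) := by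
  subst hπB
  obtain ⟨w, hw, hlo, -, hπ, hinv, hacc, -⟩ := flowSampler_exact_doeblin B hS hF hΦ hδ q hq
  have hS'c : Continuous fun U : GaugeConfig d L (Matrix.specialUnitaryGroup (Fin n) ℂ) =>
      S (WilsonFlow.coeConfig U) := hS.continuous.comp WilsonFlow.continuous_coeConfig
  haveI := isProbabilityMeasure_boltzmannMeasure (d := d) (L := L) hS'c
  have hw0 : ∀ U, 0 < w U := fun U => (Real.exp_pos _).trans_le (hlo U)
  have hfl : ∀ U, Real.exp (-(2 * δ)) ≤ (imhAcceptMass q w U).toReal := fun U => by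
    have h := ENNReal.toReal_mono
      (ne_top_of_le_ne_top ENNReal.one_ne_top (imhAcceptMass_le_one q w U)) (hacc U)
    rwa [ENNReal.toReal_ofReal (Real.exp_pos _).le] at h
  refine ⟨w, hw, hπ, hinv, hfl, fun H hH C hC => ⟨?_, ?_⟩⟩
  · exact integral_acceptFlag_mul_div_acceptRate hw hw0 hinv hH hC (Real.exp_pos _) hfl
  · have h := abs_acceptedMean_sub_mean_le_of_floor hw hw0 hinv hH hC (Real.exp_pos _) hfl
    rwa [tiltConst_exp_eq_sinh δ] at h

end Lattice

end Summit.Ventures.LatticeQCDFlow.Scoring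
end
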